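import Mathlib
import HarnessLib
import Summits.HubbardSuperconductivity.HubbardSuperconductivity.Theorems.KLProgrammeKLRegimeSplitTwoLegMomentsFamilyTools
import Summits.HubbardSuperconductivity.HubbardSuperconductivity.Theorems.KLProgrammeKLRegimeEngineV8TwoLegSpaceMomentsFamilyDoor

/-!
# Route `KLProgramme` — crux K3 ENGINE (stmt-HubbardSuperconductivity-20437 `KLRegimeEngineV17F2`), located risk #17 «(C2)-MOMENTS» (R85a)(B), producer side:
# THE ROW-FORM FAMILY DOOR AND THE COMPLETED SHELL FAMILY — `completeFamily (klAnisoFamily …)` (r2d-p1 g7) with its SHELL rows read off the degree-`d` carrier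
# (cell gate-hubbard-kl, seat hubbard-kl-k3c2-p3 g11; companion of `…EngineV8TwoLegSpaceMomentsFamilyDoor`, p620277/p621576)

`…FamilyDoor` bounds the #17 atom by a PAIR table `Σ_{(ω₀,ω₁)} Ms ω₀ ω₁` of a complete family and reads the `ω₁`-SUMMED shell rows off `klWtPinnedSumPow`
(`shellRow_spaceMomentPow_le_of_klWtPinnedSumPow`).  A pair table charges each pair at its own supremum; the carrier bounds the `ω₁`-sum at once.  This file closes the gap:

* §1 **`twoLeg_spaceMomentPow_le_of_family_rows`** (generic `G`, any complete family): if for every pinned-leg label `ω₀` the `ω₁`-SUMMED order-`d` off-diagonal pinned moment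
  of the `(ω₀,ω₁)`-sectorised two-leg kernels is `≤ Mr ω₀` (both spins, every pin), the trivial kernel's moment is `≤ Σ_{ω₀} Mr ω₀` (reindex `Fin 2 → Fin N` as pairs);
* §2 **`sectorisedKernel_completeFamily_castSucc`** — the sectorised kernels of `completeFamily F` at OLD labels are those of `F` (any degree), and the two-leg string form;
  hence **`shellRow_completeFamily_le_of_klWtPinnedSumPow`**: for `completeFamily (klAnisoFamily … K klE0 J)`, ANY `T`, rate `r`, degree `d`, the `ω₁`-summed row over the
  SHELL labels at a shell pinned label `ω₀` is `≤ (1 + 2Λ_r⁻¹)^d · klWtPinnedSumPow L M β μ K J r d 2 T 0 (x₀, ((ω₀,σ),+))` — so in the row table of the completed shell family only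
  the rows / entries touching the complement member `Fin.last` remain for the supplier's plain track.
Proofs only; nothing about the model is asserted; nothing asserts superconductivity.
References: BGM 2006 §2.3 (2.17), §2.7 (2.70)–(2.71), §3 (3.5)–(3.6) [cite: BenfattoGiulianiMastropietro2006].
-/

noncomputable section

namespace Summit.HubbardSuperconductivity.HubbardSuperconductivity.Theorems.EngineV8

set_option linter.dupNamespace false -- summit = problem name (single-conjunct summit), D-0017

open Real Finset Literature.MathematicalPhysics.QuantumLattice Literature.Probability.LatticeModels GrassmannAlgebra
open Summit.HubbardSuperconductivity.HubbardSuperconductivity.Theorems.KLRegimeSplit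
open Summit.HubbardSuperconductivity.HubbardSuperconductivity.Theorems.KLProgrammeLegKernels
open Summit.HubbardSuperconductivity.HubbardSuperconductivity.Theorems.TwoLegFourier

variable {L M : ℕ} [NeZero L] [NeZero M]

/-! ## §1 The row-form family door -/

omit [NeZero L] [NeZero M] in
/-- The two-leg label string `((0,σ),+),((0,σ),−)` as a spin/charge string. -/
private theorem twoLeg_string_eq_sc' (σ : Fin 2) :
    (![(((0 : Fin 1), σ), 0), (((0 : Fin 1), σ), 1)] : Fin 2 → SectorLeg 1) =
      fun i => (((0 : Fin 1), ((![(σ, 0), (σ, 1)] : Fin 2 → Fin 2 × Fin 2) i).1), ((![(σ, 0), (σ, 1)] : Fin 2 → Fin 2 × Fin 2) i).2) := by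
  funext i; fin_cases i <;> rfl

omit [NeZero L] [NeZero M] in
/-- The family two-leg label string with labels `ω : Fin 2 → Fin N` as `![((ω 0,σ),+), ((ω 1,σ),−)]`. -/
private theorem twoLeg_family_string_eq_sc' {N : ℕ} (σ : Fin 2) (ω : Fin 2 → Fin N) :
    (fun i => ((ω i, ((![(σ, 0), (σ, 1)] : Fin 2 → Fin 2 × Fin 2) i).1), ((![(σ, 0), (σ, 1)] : Fin 2 → Fin 2 × Fin 2) i).2)) =
      (![((ω 0, σ), 0), ((ω 1, σ), 1)] : Fin 2 → SectorLeg N) := by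
  funext i; fin_cases i <;> rfl

omit [NeZero M] in
/-- **THE ORDER-`d` OFF-DIAGONAL SPACE MOMENT FROM A ROW TABLE** (generic `G`, complete family): if for every pinned-leg label `ω₀`, spin and pin the `ω₁`-SUMMED
order-`d` off-diagonal pinned moment of the `(ω₀,ω₁)`-sectorised two-leg kernels of `G` is `≤ Mr ω₀`, then the trivial-multiplier kernel has order-`d` moment `≤ Σ_{ω₀} Mr ω₀`.
[cite: BenfattoGiulianiMastropietro2006, §2.3 (2.17), §2.7 (2.70)-(2.71)] -/
theorem twoLeg_spaceMomentPow_le_of_family_rows {β : ℝ} (hβ : 0 ≤ β) (G : HubbardGrassmann L M) {N : ℕ} {F : Fin N → FreqMomentum L M → ℂ}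
    (hF : ∀ k, ∑ ω, F ω k = 1) (d : ℕ) {Mr : Fin N → ℝ}
    (hMr : ∀ (ω₀ : Fin N) (σ : Fin 2) (x₀ : SpaceTimeIdx L M), imagTimeWeight β M *
      ∑ x ∈ (univ : Finset (Fin 2 → SpaceTimeIdx L M)).filter (fun x => x 0 = x₀ ∧ (x 1).2 ≠ (x 0).2),
        (1 + ((((x 1).2 - (x 0).2) 0).valMinAbs.natAbs : ℝ) + ((((x 1).2 - (x 0).2) 1).valMinAbs.natAbs : ℝ)) ^ d *
          ∑ ω₁ : Fin N, ‖sectorisedKernel L M β F G 2 (![((ω₀, σ), 0), ((ω₁, σ), 1)] : Fin 2 → SectorLeg N) x‖ ≤ Mr ω₀)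
    (σ : Fin 2) (x₀ : SpaceTimeIdx L M) :
    imagTimeWeight β M *
      ∑ x ∈ (univ : Finset (Fin 2 → SpaceTimeIdx L M)).filter (fun x => x 0 = x₀ ∧ (x 1).2 ≠ (x 0).2),
        (1 + ((((x 1).2 - (x 0).2) 0).valMinAbs.natAbs : ℝ) + ((((x 1).2 - (x 0).2) 1).valMinAbs.natAbs : ℝ)) ^ d *
          ‖sectorisedKernel L M β (trivialMultiplier L M) G 2 (![((0, σ), 0), ((0, σ), 1)] : Fin 2 → SectorLeg 1) x‖ ≤
      ∑ ω₀ : Fin N, Mr ω₀ := by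
  have hε : 0 ≤ imagTimeWeight β M := imagTimeWeight_nonneg hβ M
  set A := (univ : Finset (Fin 2 → SpaceTimeIdx L M)).filter (fun x => x 0 = x₀ ∧ (x 1).2 ≠ (x 0).2) with hA
  set w : (Fin 2 → SpaceTimeIdx L M) → ℝ := fun x =>
    (1 + ((((x 1).2 - (x 0).2) 0).valMinAbs.natAbs : ℝ) + ((((x 1).2 - (x 0).2) 1).valMinAbs.natAbs : ℝ)) ^ d with hw
  -- (1) the trivial kernel against the family table over label FUNCTIONS `ω : Fin 2 → Fin N`
  have h1 : ∑ x ∈ A, w x * ‖sectorisedKernel L M β (trivialMultiplier L M) G 2 (![((0, σ), 0), ((0, σ), 1)] : Fin 2 → SectorLeg 1) x‖ ≤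
      ∑ ω : Fin 2 → Fin N, ∑ x ∈ A, w x * ‖sectorisedKernel L M β F G 2 (![((ω 0, σ), 0), ((ω 1, σ), 1)] : Fin 2 → SectorLeg N) x‖ := by
    rw [twoLeg_string_eq_sc' σ]
    refine (sum_wt_norm_sectorisedKernel_trivialMultiplier_le_sum_family β hF G 2 (![(σ, 0), (σ, 1)] : Fin 2 → Fin 2 × Fin 2) A
      (w := w) (fun x _ => by rw [hw]; positivity)).trans (le_of_eq ?_)
    refine sum_congr rfl fun ω _ => ?_
    rw [twoLeg_family_string_eq_sc' σ ω]
  -- (2) reindex the label functions as pairs and swap the sums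
  have h2 : ∑ ω : Fin 2 → Fin N, ∑ x ∈ A, w x * ‖sectorisedKernel L M β F G 2 (![((ω 0, σ), 0), ((ω 1, σ), 1)] : Fin 2 → SectorLeg N) x‖ =
      ∑ ω₀ : Fin N, ∑ x ∈ A, w x * ∑ ω₁ : Fin N, ‖sectorisedKernel L M β F G 2 (![((ω₀, σ), 0), ((ω₁, σ), 1)] : Fin 2 → SectorLeg N) x‖ := by
    rw [Fintype.sum_equiv (finTwoArrowEquiv (Fin N))
      (fun ω : Fin 2 → Fin N => ∑ x ∈ A, w x * ‖sectorisedKernel L M β F G 2 (![((ω 0, σ), 0), ((ω 1, σ), 1)] : Fin 2 → SectorLeg N) x‖)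
      (fun p : Fin N × Fin N => ∑ x ∈ A, w x * ‖sectorisedKernel L M β F G 2 (![((p.1, σ), 0), ((p.2, σ), 1)] : Fin 2 → SectorLeg N) x‖)
      (fun ω => rfl), Fintype.sum_prod_type]
    refine sum_congr rfl fun ω₀ _ => ?_
    rw [sum_comm]
    refine sum_congr rfl fun x _ => ?_
    rw [mul_sum]
  calc imagTimeWeight β M * ∑ x ∈ A, w x * ‖sectorisedKernel L M β (trivialMultiplier L M) G 2 (![((0, σ), 0), ((0, σ), 1)] : Fin 2 → SectorLeg 1) x‖
      ≤ imagTimeWeight β M * ∑ ω₀ : Fin N, ∑ x ∈ A, w x * ∑ ω₁ : Fin N,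
          ‖sectorisedKernel L M β F G 2 (![((ω₀, σ), 0), ((ω₁, σ), 1)] : Fin 2 → SectorLeg N) x‖ := by
        rw [← h2]; exact mul_le_mul_of_nonneg_left h1 hε
    _ = ∑ ω₀ : Fin N, imagTimeWeight β M * ∑ x ∈ A, w x * ∑ ω₁ : Fin N,
          ‖sectorisedKernel L M β F G 2 (![((ω₀, σ), 0), ((ω₁, σ), 1)] : Fin 2 → SectorLeg N) x‖ := by rw [mul_sum]
    _ ≤ ∑ ω₀ : Fin N, Mr ω₀ := sum_le_sum fun ω₀ _ => hMr ω₀ σ x₀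

omit [NeZero M] in
/-- **THE #17 ATOM FROM A ROW TABLE** of a complete family for `G' = klEffectiveAction … K klE0 n − counterQuadratic … K`. -/
theorem twoLegSpaceMomentAt_of_family_rows {β : ℝ} (hβ : 0 ≤ β) (U μ : ℝ) (K : TrigPolyC4v) (n d : ℕ) {N : ℕ} {F : Fin N → FreqMomentum L M → ℂ}
    (hF : ∀ k, ∑ ω, F ω k = 1) {Mr : Fin N → ℝ}
    (hMr : ∀ (ω₀ : Fin N) (σ : Fin 2) (x₀ : SpaceTimeIdx L M), imagTimeWeight β M *
      ∑ x ∈ (univ : Finset (Fin 2 → SpaceTimeIdx L M)).filter (fun x => x 0 = x₀ ∧ (x 1).2 ≠ (x 0).2),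
        (1 + ((((x 1).2 - (x 0).2) 0).valMinAbs.natAbs : ℝ) + ((((x 1).2 - (x 0).2) 1).valMinAbs.natAbs : ℝ)) ^ d *
          ∑ ω₁ : Fin N, ‖sectorisedKernel L M β F (KLProgrammeLegKernels.klEffectiveAction L M β U μ K klE0 n - counterQuadratic L M β K) 2
            (![((ω₀, σ), 0), ((ω₁, σ), 1)] : Fin 2 → SectorLeg N) x‖ ≤ Mr ω₀) :
    TwoLegSpaceMomentAt L M (∑ ω₀ : Fin N, Mr ω₀) β U μ K n d :=
  fun σ x₀ => twoLeg_spaceMomentPow_le_of_family_rows hβ _ hF d hMr σ x₀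

/-! ## §2 The completed shell family: old labels read the shell family, so the shell rows come from the carrier -/

omit [NeZero M] in
/-- **The sectorised kernels of `completeFamily F` at OLD labels are those of `F`** (any degree; the kernel depends on the family only through the legs' members). -/
theorem sectorisedKernel_completeFamily_castSucc {N : ℕ} (β : ℝ) (F : Fin N → FreqMomentum L M → ℂ) (G : HubbardGrassmann L M) (m : ℕ)
    (Ω : Fin m → SectorLeg N) (x : Fin m → SpaceTimeIdx L M) :
    sectorisedKernel L M β (completeFamily F) G m (fun i => ((Fin.castSucc (Ω i).1.1, (Ω i).1.2), (Ω i).2)) x = sectorisedKernel L M β F G m Ω x := by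
  simp only [sectorisedKernel_def, completeFamily_castSucc]

omit [NeZero M] in
/-- The two-leg string form of `sectorisedKernel_completeFamily_castSucc`. -/
theorem sectorisedKernel_completeFamily_castSucc_two {N : ℕ} (β : ℝ) (F : Fin N → FreqMomentum L M → ℂ) (G : HubbardGrassmann L M)
    (ω₀ ω₁ : Fin N) (σ : Fin 2) (x : Fin 2 → SpaceTimeIdx L M) :
    sectorisedKernel L M β (completeFamily F) G 2 (![((Fin.castSucc ω₀, σ), 0), ((Fin.castSucc ω₁, σ), 1)] : Fin 2 → SectorLeg (N + 1)) x =
      sectorisedKernel L M β F G 2 (![((ω₀, σ), 0), ((ω₁, σ), 1)] : Fin 2 → SectorLeg N) x := by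
  have h := sectorisedKernel_completeFamily_castSucc β F G 2 (![((ω₀, σ), 0), ((ω₁, σ), 1)] : Fin 2 → SectorLeg N) x
  have hs : (fun i => ((Fin.castSucc ((![((ω₀, σ), 0), ((ω₁, σ), 1)] : Fin 2 → SectorLeg N) i).1.1,
      ((![((ω₀, σ), 0), ((ω₁, σ), 1)] : Fin 2 → SectorLeg N) i).1.2), ((![((ω₀, σ), 0), ((ω₁, σ), 1)] : Fin 2 → SectorLeg N) i).2)) =
      (![((Fin.castSucc ω₀, σ), 0), ((Fin.castSucc ω₁, σ), 1)] : Fin 2 → SectorLeg (N + 1)) := by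
    funext i; fin_cases i <;> rfl
  rw [hs] at h
  exact h

/-- **THE SHELL ROWS OF THE COMPLETED SHELL FAMILY FROM THE DEGREE-`d` CARRIER**: for `completeFamily (klAnisoFamily … K klE0 J)`, ANY `T`, rate `r`, degree `d`, spin `σ`,
a SHELL pinned label `ω₀` and pin `x₀`, the row summed over the SHELL labels `ω₁` is `≤ (1 + 2Λ_r⁻¹)^d · klWtPinnedSumPow L M β μ K J r d 2 T 0 (x₀, ((ω₀,σ),+))`
(the entries with the complement member `Fin.last` are not included — they are the supplier's plain track). [cite: BenfattoGiulianiMastropietro2006, §3 (3.5)-(3.6)] -/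
theorem shellRow_completeFamily_le_of_klWtPinnedSumPow {β : ℝ} (hβ : 0 ≤ β) (μ : ℝ) (K : TrigPolyC4v) (J r d : ℕ) (T : HubbardGrassmann L M)
    (σ : Fin 2) (ω₀ : Fin (sectorCount J)) (x₀ : SpaceTimeIdx L M) :
    imagTimeWeight β M *
      ∑ x ∈ (univ : Finset (Fin 2 → SpaceTimeIdx L M)).filter (fun x => x 0 = x₀ ∧ (x 1).2 ≠ (x 0).2),
        (1 + ((((x 1).2 - (x 0).2) 0).valMinAbs.natAbs : ℝ) + ((((x 1).2 - (x 0).2) 1).valMinAbs.natAbs : ℝ)) ^ d *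
          ∑ ω₁ : Fin (sectorCount J), ‖sectorisedKernel L M β (completeFamily (klAnisoFamily L M β μ K klE0 J)) T 2
            (![((Fin.castSucc ω₀, σ), 0), ((Fin.castSucc ω₁, σ), 1)] : Fin 2 → SectorLeg (sectorCount J + 1)) x‖ ≤
      (1 + 2 * (klScale klE0 r)⁻¹) ^ d * klWtPinnedSumPow L M β μ K J r d 2 T 0 (x₀, ((ω₀, σ), 0)) := by
  simp only [sectorisedKernel_completeFamily_castSucc_two]
  exact shellRow_spaceMomentPow_le_of_klWtPinnedSumPow hβ μ K J r d T σ ω₀ x₀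

end Summit.HubbardSuperconductivity.HubbardSuperconductivity.Theorems.EngineV8

end
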